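import Summits.AtomisticToContinuum.BoseEinsteinCondensation.Theorems.BECThomsonPrincipleGDTransferSeededCompactDefs

/-!
# Route `BECThomsonPrinciple`, crux `GDTransfer` (stmt-AtomisticToContinuum-9482), line `seeded-continuity`
# (skeleton v8): registered stub `stub_energyUpperL1` — upper semicontinuity of the periodic ground-state
# energy under dilation of an integrable profile

Supports (does not close) stmt-AtomisticToContinuum-9482: proves the registered stub
`stub_energyUpperL1 : Sig.stub_energyUpperL1` (statement (U) `EnergyUpperL1` of
`BECThomsonPrincipleGDTransferSeededCompactDefs.lean`).

For an admissible profile `v`, finite on `[0, ∞)` and with integrable lift `∫_{ℝ³} v(|x|) dx < ∞`, at fixed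
particle number `m + 1` and side `L > 0`: for every `ε > 0` there is `ϑ > 0` with
`E₀(b⁻²v(·/b), m + 1, L) ≤ E₀(v, m + 1, L) + ε` whenever `0 < b`, `|b − 1| < ϑ`.

Proof.  `E₀(v) < ∞` (`periodicGroundStateEnergy_ne_top_of_integrable`), so there is ONE `C¹` near-minimiser
`Φ` with `E_v(Φ) ≤ E₀(v) + ε/2`; being continuous, `Φ` is bounded on the (relatively compact) cell,
`|Φ| ≤ B`.  The defect profile `w_b := |b⁻²v(·/b) − v|` (difference of the finite real values) sandwiches
`b⁻²v(|x|/b) ≤ v(|x|) + w_b(|x|)` (`dil_le_add_ofReal_abs_sub`), so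
`E_{v_b}(Φ) ≤ E_v(Φ) + ∫_{cell^N} W_{w_b}|Φ|² ≤ E_v(Φ) + B² C(N, L) ‖w_b‖_{L¹(ℝ³)}`
(`ScaledClose.periodicInteraction_le_add_of_pointwise`, `ScaledClose.periodicEnergy_le_add_interaction`, and
the first-particle recursion `∫_{cell^{m+1}} W_w = m ‖w‖₁ L^{3m} + L³ ∫_{cell^m} W_w`, whence
`∫_{cell^N} W_w ≤ C(N, L) ‖w‖₁`); finally `‖w_b‖₁ → 0` as `b → 1` is the `L¹(ℝ³)`-continuity of dilations
`dil_integral_dilate_sub_le` applied to the integrable lift `x ↦ v(|x|).toReal`.  [folklore] bookkeeping over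
landed tree lemmas.

References: LSSY2005 Ch. 5, footnote to (5.3) (scaling of the torus problem) — background only.
-/

noncomputable section

open MeasureTheory Filter Set Metric
open scoped ENNReal NNReal Topology

namespace Summit.AtomisticToContinuum.BoseEinsteinCondensation.Cruxes.GDTransfer.Seeded

open Literature.MathematicalPhysics.QuantumManyBody.BoseGas
open Literature.Barriers.AtomisticToContinuum.BoseGas (scaledPotential)
open Summit.AtomisticToContinuum.BoseEinsteinCondensation.Cruxes.HardCoreExtension.ThirdLawCurrentFloor
  (exists_periodicEnergy_le_add)

namespace EnergyUpperL1

variable {L : ℝ}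

/-- **First-particle recursion for the cell integral of the pair interaction**: for `L > 0` and a measurable
profile `w`, `∫_{cell^{m+1}} W_w = m · (∫_{ℝ³} w(|y|) dy) · L^{3m} + (∫_{cell^m} W_w) · L³` (Tonelli in the
first particle, `∑_{i<j} = ∑_{0<j} + ∑_{1≤i<j}`, and the tiling identity
`∫_{[0,L)³} w^per(x - y) dx = ∫_{ℝ³} w(|z|) dz`). [folklore] -/
theorem lintegral_cellN_succ_periodicInteraction (hL : 0 < L) {w : ℝ → ℝ≥0∞} (hw : Measurable w) (m : ℕ) :
    ∫⁻ X in cellN (m + 1) L, periodicInteraction w L X =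
      (m : ℝ≥0∞) * (∫⁻ z : Space, w ‖z‖) * (ENNReal.ofReal L ^ 3) ^ m +
        (∫⁻ Y in cellN m L, periodicInteraction w L Y) * ENNReal.ofReal L ^ 3 := by
  -- adapted from `InteractionExcess.lintegral_cellN_succ_periodicInteraction`
  -- (Theorems/BECConjugateDominationHardCoreExtensionInteractionExcess.lean)
  have hinner : ∀ Y : Config m, ∫⁻ x in cell L, periodicInteraction w L (Matrix.vecCons x Y) =
      (m : ℝ≥0∞) * (∫⁻ z : Space, w ‖z‖) + periodicInteraction w L Y * ENNReal.ofReal L ^ 3 := by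
    intro Y
    have hfun : (fun x : Space => periodicInteraction w L (Matrix.vecCons x Y)) =
        fun x => (∑ j : Fin m, periodizedPotential w L (x - Y j)) + periodicInteraction w L Y := by
      funext x
      rw [periodicInteraction_succ]
      simp only [Matrix.cons_val_zero, Matrix.cons_val_succ, Matrix.tail_cons]
    have hmj : ∀ j : Fin m, Measurable fun x : Space => periodizedPotential w L (x - Y j) := fun j =>
      (measurable_periodizedPotential hw L).comp (measurable_id.sub_const (Y j))
    rw [hfun, lintegral_add_right _ measurable_const, lintegral_finsetSum _ (fun j _ => hmj j),
      setLIntegral_const, volume_cell]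
    simp only [lintegral_cell_periodizedPotential_sub hL hw, Finset.sum_const, Finset.card_univ,
      Fintype.card_fin, nsmul_eq_mul]
  rw [lintegral_cellN_succ L (measurable_periodicInteraction hw L)]
  simp only [hinner]
  rw [lintegral_add_left measurable_const, setLIntegral_const, volume_cellN,
    lintegral_mul_const _ (measurable_periodicInteraction hw L)]

/-- **The cell integral of the pair interaction is controlled by the `L¹(ℝ³)`-norm of the profile**: at fixed
`(N, L)`, `L > 0`, there is a finite constant `C = C(N, L)` with `∫_{cell^N} W_w ≤ C ‖w(|·|)‖_{L¹(ℝ³)}` for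
every measurable profile `w` (induction on `N` through `lintegral_cellN_succ_periodicInteraction`; in fact
`C = (N choose 2) L^{3(N-1)}`). [folklore] -/
theorem exists_lintegral_cellN_periodicInteraction_le (hL : 0 < L) (N : ℕ) :
    ∃ C : ℝ≥0∞, C ≠ ⊤ ∧ ∀ w : ℝ → ℝ≥0∞, Measurable w →
      ∫⁻ X in cellN N L, periodicInteraction w L X ≤ C * ∫⁻ z : Space, w ‖z‖ := by
  induction N with
  | zero =>
    refine ⟨0, ENNReal.zero_ne_top, fun w _ => ?_⟩
    have h0 : ∀ X : Config 0, periodicInteraction w L X = 0 := fun X => by simp [periodicInteraction]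
    simp [h0]
  | succ m ih =>
    obtain ⟨C, hC, hCw⟩ := ih
    refine ⟨(m : ℝ≥0∞) * (ENNReal.ofReal L ^ 3) ^ m + C * ENNReal.ofReal L ^ 3, ?_, fun w hw => ?_⟩
    · exact ENNReal.add_ne_top.2
        ⟨ENNReal.mul_ne_top (ENNReal.natCast_ne_top m)
            (ENNReal.pow_ne_top (ENNReal.pow_ne_top ENNReal.ofReal_ne_top)),
          ENNReal.mul_ne_top hC (ENNReal.pow_ne_top ENNReal.ofReal_ne_top)⟩
    · rw [lintegral_cellN_succ_periodicInteraction hL hw m]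
      calc (m : ℝ≥0∞) * (∫⁻ z : Space, w ‖z‖) * (ENNReal.ofReal L ^ 3) ^ m +
            (∫⁻ Y in cellN m L, periodicInteraction w L Y) * ENNReal.ofReal L ^ 3
          ≤ (m : ℝ≥0∞) * (∫⁻ z : Space, w ‖z‖) * (ENNReal.ofReal L ^ 3) ^ m +
            (C * ∫⁻ z : Space, w ‖z‖) * ENNReal.ofReal L ^ 3 :=
            add_le_add le_rfl (mul_le_mul' (hCw w hw) le_rfl)
        _ = ((m : ℝ≥0∞) * (ENNReal.ofReal L ^ 3) ^ m + C * ENNReal.ofReal L ^ 3) *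
            ∫⁻ z : Space, w ‖z‖ := by ring

end EnergyUpperL1

open EnergyUpperL1 ScaledClose in
/-- **Registered stub `stub_energyUpperL1`** (skeleton v8, line `seeded-continuity`; statement (U)
`EnergyUpperL1`): for an admissible profile `v` finite on `[0, ∞)` with integrable lift, at fixed `(m + 1, L)`,
`E₀(b⁻²v(·/b), m + 1, L) ≤ E₀(v, m + 1, L) + ε` for all `b > 0` with `|b − 1| < ϑ(ε)`.  One bounded `C¹`
near-minimiser of `v` is tested against the scaled potential; the dilation defect is `L¹(ℝ³)`-small
(`dil_integral_dilate_sub_le`) and its cell interaction is `≤ C(N, L)‖·‖₁`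
(`EnergyUpperL1.exists_lintegral_cellN_periodicInteraction_le`). [folklore] -/
theorem stub_energyUpperL1 : Sig.stub_energyUpperL1 := by
  intro v hv hfin hint m L hL ε hε
  have hmeas : Measurable v := hv.1
  -- (1) the ground-state energy is finite; one near-minimiser `Φ` of `v` at slack `ε / 2`
  have hE : periodicGroundStateEnergy v (m + 1) L ≠ ⊤ :=
    periodicGroundStateEnergy_ne_top_of_integrable hmeas hint m hL
  have hε2 : (0 : ℝ≥0∞) < ENNReal.ofReal (ε / 2) := ENNReal.ofReal_pos.2 (by positivity)
  obtain ⟨Φ, hΦ⟩ := exists_periodicEnergy_le_add v hE hε2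
  -- (2) `Φ.ψ` is continuous, hence bounded on the cell (which lies in the compact closed box)
  obtain ⟨B, hB⟩ : ∃ B : ℝ, ∀ X ∈ cellN (m + 1) L, ‖Φ.ψ X‖ ≤ B := by
    obtain ⟨B, hB⟩ := (isCompact_closedBoxN (m + 1) L).exists_bound_of_continuousOn
      Φ.contDiff.continuous.continuousOn
    exact ⟨B, fun X hX => hB X (cellN_subset_closedBoxN (m + 1) L hX)⟩
  have hB2 : ∀ X ∈ cellN (m + 1) L, (‖Φ.ψ X‖₊ : ℝ≥0∞) ^ 2 ≤ ENNReal.ofReal (B ^ 2) := by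
    intro X hX
    rw [← enorm_eq_nnnorm, ← ofReal_norm, ← ENNReal.ofReal_pow (norm_nonneg _)]
    exact ENNReal.ofReal_le_ofReal (pow_le_pow_left₀ (norm_nonneg _) (hB X hX) 2)
  -- (3) the cell constant `C(N, L)` of the pair interaction
  obtain ⟨C, hC, hCw⟩ := exists_lintegral_cellN_periodicInteraction_le hL (m + 1)
  -- (4) the `L¹`-tolerance `η` with `B² C η ≤ ε / 2`
  set K : ℝ := (ENNReal.ofReal (B ^ 2) * C).toReal with hK
  have hK0 : 0 ≤ K := ENNReal.toReal_nonneg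
  set η : ℝ := ε / 2 / (K + 1) with hη
  have hη0 : 0 < η := by positivity
  have hKη : K * η ≤ ε / 2 := by
    rw [hη, mul_div_assoc', div_le_iff₀ (by positivity)]
    nlinarith
  -- (5) the real lift `F ∈ L¹(ℝ³)` and the `L¹`-continuity of its dilations
  set F : Space → ℝ := fun x => (v ‖x‖).toReal with hFdef
  have hFint : Integrable F :=
    integrable_toReal_of_lintegral_ne_top (hmeas.comp measurable_norm).aemeasurable hint
  obtain ⟨ϑ, hϑ, hclose⟩ := dil_integral_dilate_sub_le hFint hη0
  refine ⟨ϑ, hϑ, fun b hb0 hbϑ => ?_⟩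
  -- (6) the scaled profile: closed form, finiteness on `[0, ∞)`, real value, measurability
  have hsc : ∀ r, scaledPotential v b r = ENNReal.ofReal (b ^ 2)⁻¹ * v (r / b) := fun r => by
    simp only [scaledPotential]
    rw [ENNReal.ofReal_inv_of_pos (by positivity)]
  have hscfin : ∀ r, 0 ≤ r → scaledPotential v b r ≠ ⊤ := fun r hr => by
    rw [hsc]
    exact ENNReal.mul_ne_top ENNReal.ofReal_ne_top (hfin _ (div_nonneg hr hb0.le))
  have hscR : ∀ r, (scaledPotential v b r).toReal = (b ^ 2)⁻¹ * (v (r / b)).toReal := fun r => by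
    rw [hsc, ENNReal.toReal_mul, ENNReal.toReal_ofReal (inv_nonneg.2 (sq_nonneg b))]
  have hscm : Measurable (scaledPotential v b) := (hmeas.comp (measurable_id.div_const b)).const_mul _
  -- (7) the defect profile `w = |v_b - v|`: measurable, sandwich, `L¹`-small
  set w : ℝ → ℝ≥0∞ := fun r => ENNReal.ofReal |(scaledPotential v b r).toReal - (v r).toReal| with hwdef
  have hwm : Measurable w :=
    (continuous_abs.measurable.comp (hscm.ennreal_toReal.sub hmeas.ennreal_toReal)).ennreal_ofReal
  have hsand : ∀ x : Space, scaledPotential v b ‖x‖ ≤ v ‖x‖ + w ‖x‖ := fun x =>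
    dil_le_add_ofReal_abs_sub (hscfin _ (norm_nonneg x)) (hfin _ (norm_nonneg x))
  have hwL1 : ∫⁻ x : Space, w ‖x‖ ≤ ENNReal.ofReal η := by
    have hwx : ∀ x : Space, w ‖x‖ = ENNReal.ofReal |(b ^ 2)⁻¹ * F (b⁻¹ • x) - F x| := fun x => by
      simp only [hwdef, hscR, hFdef, norm_smul, norm_inv, Real.norm_of_nonneg hb0.le, div_eq_inv_mul]
    have hI : Integrable (fun x : Space => |(b ^ 2)⁻¹ * F (b⁻¹ • x) - F x|) :=
      (((hFint.comp_smul (inv_ne_zero hb0.ne')).const_mul _).sub hFint).abs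
    calc ∫⁻ x : Space, w ‖x‖
        = ∫⁻ x : Space, ENNReal.ofReal |(b ^ 2)⁻¹ * F (b⁻¹ • x) - F x| := lintegral_congr fun x => hwx x
      _ = ENNReal.ofReal (∫ x : Space, |(b ^ 2)⁻¹ * F (b⁻¹ • x) - F x|) :=
          (ofReal_integral_eq_lintegral_ofReal hI (ae_of_all _ fun x => abs_nonneg _)).symm
      _ ≤ ENNReal.ofReal η := ENNReal.ofReal_le_ofReal (hclose b hbϑ)
  -- (8) the extra interaction of the defect against the bounded near-minimiser is `≤ ε / 2`
  have hint₁ : ∀ X : Config (m + 1), periodicInteraction (scaledPotential v b) L X ≤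
      periodicInteraction v L X + periodicInteraction w L X :=
    fun X => periodicInteraction_le_add_of_pointwise hsand L X
  have hextra : ∫⁻ X in cellN (m + 1) L, periodicInteraction w L X * (‖Φ.ψ X‖₊ : ℝ≥0∞) ^ 2 ≤
      ENNReal.ofReal (ε / 2) :=
    calc ∫⁻ X in cellN (m + 1) L, periodicInteraction w L X * (‖Φ.ψ X‖₊ : ℝ≥0∞) ^ 2
        ≤ ∫⁻ X in cellN (m + 1) L, periodicInteraction w L X * ENNReal.ofReal (B ^ 2) :=
          setLIntegral_mono' (measurableSet_cellN (m + 1) L) fun X hX => mul_le_mul' le_rfl (hB2 X hX)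
      _ = (∫⁻ X in cellN (m + 1) L, periodicInteraction w L X) * ENNReal.ofReal (B ^ 2) :=
          lintegral_mul_const _ (measurable_periodicInteraction hwm L)
      _ ≤ (C * ∫⁻ x : Space, w ‖x‖) * ENNReal.ofReal (B ^ 2) := mul_le_mul' (hCw w hwm) le_rfl
      _ ≤ (C * ENNReal.ofReal η) * ENNReal.ofReal (B ^ 2) :=
          mul_le_mul' (mul_le_mul' le_rfl hwL1) le_rfl
      _ = (ENNReal.ofReal (B ^ 2) * C) * ENNReal.ofReal η := by ring
      _ = ENNReal.ofReal K * ENNReal.ofReal η := by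
          rw [hK, ENNReal.ofReal_toReal (ENNReal.mul_ne_top ENNReal.ofReal_ne_top hC)]
      _ = ENNReal.ofReal (K * η) := (ENNReal.ofReal_mul hK0).symm
      _ ≤ ENNReal.ofReal (ε / 2) := ENNReal.ofReal_le_ofReal hKη
  -- (9) the chain `E₀(v_b) ≤ E_{v_b}(Φ) ≤ E_v(Φ) + ε/2 ≤ E₀(v) + ε`
  calc periodicGroundStateEnergy (scaledPotential v b) (m + 1) L
      ≤ periodicEnergy (scaledPotential v b) Φ := iInf_le _ _
    _ ≤ periodicEnergy v Φ +
          ∫⁻ X in cellN (m + 1) L, periodicInteraction w L X * (‖Φ.ψ X‖₊ : ℝ≥0∞) ^ 2 :=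
        periodicEnergy_le_add_interaction hwm hint₁ Φ
    _ ≤ periodicGroundStateEnergy v (m + 1) L + ENNReal.ofReal (ε / 2) + ENNReal.ofReal (ε / 2) :=
        add_le_add hΦ hextra
    _ = periodicGroundStateEnergy v (m + 1) L + ENNReal.ofReal ε := by
        rw [add_assoc, ← ENNReal.ofReal_add (by positivity) (by positivity), add_halves]

end Summit.AtomisticToContinuum.BoseEinsteinCondensation.Cruxes.GDTransfer.Seeded

end
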